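import Mathlib

/-!
# Parseval / level form of the coset sum of the crux `CosetDecorrelation` (line `SketchIdeator3`)

Stub `stub_cosetParseval` of the crux `CosetDecorrelation`
(`Summit.Parity.GeneralizedHardyLittlewood.Theses.LiouvilleMAD`, stmt-Parity-13317), line
`SketchIdeator3` of crux stmt-Parity-13317 (card `farey-level-mean-coupling`); Mathlib only.

For general real weights `f g : ℕ → ℝ`, a scale `M` and a modulus `j ≥ 1` we prove the PARSEVAL
identity on `ℤ/j`
`j · Σ_{(m,m') ∈ (M,2M]², m ≡ m' (mod j)} f(m) g(m') = Σ_{b<j} Ĝ_f(b/j) · conj Ĝ_g(b/j)`,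
`Ĝ_f(b/j) = Σ_{m ∈ (M,2M]} f(m) e(bm/j)`.  Its `b = 0` term is the level-1 (mean × mean) term
`(Σ f)(Σ g)` of the line's normal form; the terms `b ≠ 0` are the fluctuation.

Proof: expand the right-hand side (`conj` of a sum of real × exponential is the sum of
real × exponential at the negated phase), swap the three sums, and use the orthogonality relation
`Σ_{b<j} e(b(m − m')/j) = j · [j ∣ m − m']` (geometric sum of a `j`-th root of unity,
`Complex.exp_eq_one_iff`, `geom_sum_eq`); the left-hand side is the same double sum after
`Finset.sum_filter` / `Finset.sum_product` and `Nat.modEq_iff_dvd`.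
-/

namespace Summit.Parity.GeneralizedHardyLittlewood.Theorems.CosetDecorrelation.FareyLevelMeanCoupling

open Finset

/-- Conjugating the character value `e(bm/j)` negates its phase. [folklore] -/
theorem parseval_conj_exp (b m j : ℕ) :
    (starRingEnd ℂ) (Complex.exp (2 * Real.pi * Complex.I * ((b : ℂ) * (m : ℂ) / (j : ℂ)))) =
      Complex.exp (-(2 * Real.pi * Complex.I * ((b : ℂ) * (m : ℂ) / (j : ℂ)))) := by
  rw [← Complex.exp_conj]
  congr 1
  simp only [map_mul, map_div₀, map_natCast, map_ofNat, Complex.conj_ofReal, Complex.conj_I]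
  ring

/-- `e(bm/j) · conj e(bm'/j) = ζ^b` with `ζ = e((m − m')/j)`. [folklore] -/
theorem parseval_exp_mul_conj_exp (b m m' j : ℕ) :
    Complex.exp (2 * Real.pi * Complex.I * ((b : ℂ) * (m : ℂ) / (j : ℂ))) *
        (starRingEnd ℂ) (Complex.exp (2 * Real.pi * Complex.I * ((b : ℂ) * (m' : ℂ) / (j : ℂ)))) =
      Complex.exp (2 * Real.pi * Complex.I * ((((m : ℤ) - (m' : ℤ) : ℤ) : ℂ) / (j : ℂ))) ^ b := by
  rw [parseval_conj_exp, ← Complex.exp_add, ← Complex.exp_nat_mul]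
  congr 1
  push_cast
  ring

/-- Orthogonality of the additive characters of `ℤ/j`: for `j ≥ 1` and `k : ℤ`,
`Σ_{b<j} e(k/j)^b = j` if `j ∣ k` and `0` otherwise (geometric sum of a `j`-th root of unity).
[folklore] -/
theorem parseval_geom_sum (j : ℕ) (hj : 1 ≤ j) (k : ℤ) :
    ∑ b ∈ Finset.range j, Complex.exp (2 * Real.pi * Complex.I * ((k : ℂ) / (j : ℂ))) ^ b =
      if (j : ℤ) ∣ k then (j : ℂ) else 0 := by
  have hj0 : (j : ℂ) ≠ 0 := by exact_mod_cast (Nat.one_le_iff_ne_zero.mp hj)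
  have h2pi : (2 * Real.pi * Complex.I : ℂ) ≠ 0 := by
    simp [Real.pi_ne_zero, Complex.I_ne_zero]
  split_ifs with hdvd
  · obtain ⟨c, hc⟩ := hdvd
    have h1 : Complex.exp (2 * Real.pi * Complex.I * ((k : ℂ) / (j : ℂ))) = 1 := by
      have harg : 2 * Real.pi * Complex.I * ((k : ℂ) / (j : ℂ)) =
          (c : ℂ) * (2 * Real.pi * Complex.I) := by
        rw [hc]
        push_cast
        field_simp
      rw [harg]
      exact Complex.exp_int_mul_two_pi_mul_I c
    rw [h1]
    simp
  · have hne : Complex.exp (2 * Real.pi * Complex.I * ((k : ℂ) / (j : ℂ))) ≠ 1 := by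
      intro h
      rw [Complex.exp_eq_one_iff] at h
      obtain ⟨n, hn⟩ := h
      apply hdvd
      refine ⟨n, ?_⟩
      have h2 : (2 * Real.pi * Complex.I : ℂ) * (k : ℂ) =
          (2 * Real.pi * Complex.I) * ((j : ℂ) * (n : ℂ)) := by
        have this : 2 * Real.pi * Complex.I * ((k : ℂ) / (j : ℂ)) * (j : ℂ) =
            (n : ℂ) * (2 * Real.pi * Complex.I) * (j : ℂ) := by rw [hn]
        rw [mul_assoc, div_mul_cancel₀ _ hj0] at this
        rw [this]
        ring
      have h3 := mul_left_cancel₀ h2pi h2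
      exact_mod_cast h3
    rw [geom_sum_eq hne]
    have hpow : Complex.exp (2 * Real.pi * Complex.I * ((k : ℂ) / (j : ℂ))) ^ j = 1 := by
      rw [← Complex.exp_nat_mul]
      have harg : (j : ℂ) * (2 * Real.pi * Complex.I * ((k : ℂ) / (j : ℂ))) =
          (k : ℂ) * (2 * Real.pi * Complex.I) := by
        field_simp
      rw [harg]
      exact Complex.exp_int_mul_two_pi_mul_I k
    rw [hpow, sub_self, zero_div]

/-- Orthogonality in the form used: `Σ_{b<j} e(bm/j) conj e(bm'/j) = j·[m ≡ m' (mod j)]`.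
[folklore] -/
theorem parseval_orthogonality (m m' j : ℕ) (hj : 1 ≤ j) :
    ∑ b ∈ Finset.range j,
        Complex.exp (2 * Real.pi * Complex.I * ((b : ℂ) * (m : ℂ) / (j : ℂ))) *
          (starRingEnd ℂ) (Complex.exp (2 * Real.pi * Complex.I * ((b : ℂ) * (m' : ℂ) / (j : ℂ)))) =
      if m ≡ m' [MOD j] then (j : ℂ) else 0 := by
  simp_rw [parseval_exp_mul_conj_exp]
  rw [parseval_geom_sum j hj]
  have hiff : ((j : ℤ) ∣ ((m : ℤ) - (m' : ℤ))) ↔ m ≡ m' [MOD j] := by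
    rw [Nat.modEq_iff_dvd, dvd_sub_comm]
  simp only [hiff]

/-- **Parseval on `ℤ/j`** for the coset sum (stub `stub_cosetParseval`, line `SketchIdeator3` of
crux stmt-Parity-13317): for real weights `f, g`, a scale `M` and a modulus `j ≥ 1`,
`j · Σ_{(m,m') ∈ (M,2M]², m ≡ m' (mod j)} f(m) g(m') = Σ_{b<j} Ĝ_f(b/j) · conj Ĝ_g(b/j)` with
`Ĝ_f(b/j) = Σ_{m ∈ (M,2M]} f(m) e(bm/j)`.  The `b = 0` term is the level-1 term `(Σ f)(Σ g)`.
[folklore] -/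
theorem stub_cosetParseval :
    ∀ (f g : ℕ → ℝ) (M j : ℕ), 1 ≤ j →
      ((j : ℂ) * ((∑ p ∈ (Finset.Ioc M (2 * M) ×ˢ Finset.Ioc M (2 * M)).filter
            (fun p : ℕ × ℕ => p.1 ≡ p.2 [MOD j]), f p.1 * g p.2 : ℝ) : ℂ))
      = ∑ b ∈ Finset.range j,
          (∑ m ∈ Finset.Ioc M (2 * M),
              (f m : ℂ) * Complex.exp (2 * Real.pi * Complex.I * ((b : ℂ) * (m : ℂ) / (j : ℂ)))) *
          (starRingEnd ℂ) (∑ m ∈ Finset.Ioc M (2 * M),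
              (g m : ℂ) * Complex.exp (2 * Real.pi * Complex.I * ((b : ℂ) * (m : ℂ) / (j : ℂ)))) := by
  intro f g M j hj
  -- the right-hand side, expanded and with the `b`-sum innermost
  have hR : (∑ b ∈ Finset.range j,
          (∑ m ∈ Finset.Ioc M (2 * M),
              (f m : ℂ) * Complex.exp (2 * Real.pi * Complex.I * ((b : ℂ) * (m : ℂ) / (j : ℂ)))) *
          (starRingEnd ℂ) (∑ m ∈ Finset.Ioc M (2 * M),
              (g m : ℂ) * Complex.exp (2 * Real.pi * Complex.I * ((b : ℂ) * (m : ℂ) / (j : ℂ)))))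
        = ∑ m ∈ Finset.Ioc M (2 * M), ∑ m' ∈ Finset.Ioc M (2 * M),
            (f m : ℂ) * (g m' : ℂ) * (if m ≡ m' [MOD j] then (j : ℂ) else 0) := by
    calc (∑ b ∈ Finset.range j,
          (∑ m ∈ Finset.Ioc M (2 * M),
              (f m : ℂ) * Complex.exp (2 * Real.pi * Complex.I * ((b : ℂ) * (m : ℂ) / (j : ℂ)))) *
          (starRingEnd ℂ) (∑ m ∈ Finset.Ioc M (2 * M),
              (g m : ℂ) * Complex.exp (2 * Real.pi * Complex.I * ((b : ℂ) * (m : ℂ) / (j : ℂ)))))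
        = ∑ b ∈ Finset.range j, ∑ m ∈ Finset.Ioc M (2 * M), ∑ m' ∈ Finset.Ioc M (2 * M),
            (f m : ℂ) * (g m' : ℂ) *
              (Complex.exp (2 * Real.pi * Complex.I * ((b : ℂ) * (m : ℂ) / (j : ℂ))) *
                (starRingEnd ℂ)
                  (Complex.exp (2 * Real.pi * Complex.I * ((b : ℂ) * (m' : ℂ) / (j : ℂ))))) := by
          refine sum_congr rfl fun b _ => ?_
          rw [map_sum, sum_mul_sum]
          refine sum_congr rfl fun m _ => sum_congr rfl fun m' _ => ?_
          rw [map_mul, Complex.conj_ofReal]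
          ring
      _ = ∑ m ∈ Finset.Ioc M (2 * M), ∑ m' ∈ Finset.Ioc M (2 * M), ∑ b ∈ Finset.range j,
            (f m : ℂ) * (g m' : ℂ) *
              (Complex.exp (2 * Real.pi * Complex.I * ((b : ℂ) * (m : ℂ) / (j : ℂ))) *
                (starRingEnd ℂ)
                  (Complex.exp (2 * Real.pi * Complex.I * ((b : ℂ) * (m' : ℂ) / (j : ℂ))))) := by
          rw [sum_comm]
          exact sum_congr rfl fun m _ => sum_comm
      _ = ∑ m ∈ Finset.Ioc M (2 * M), ∑ m' ∈ Finset.Ioc M (2 * M),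
            (f m : ℂ) * (g m' : ℂ) * (if m ≡ m' [MOD j] then (j : ℂ) else 0) := by
          refine sum_congr rfl fun m _ => sum_congr rfl fun m' _ => ?_
          rw [← mul_sum, parseval_orthogonality m m' j hj]
  rw [hR, Complex.ofReal_sum, sum_filter, sum_product, mul_sum]
  refine sum_congr rfl fun m _ => ?_
  rw [mul_sum]
  refine sum_congr rfl fun m' _ => ?_
  split_ifs
  · push_cast
    ring
  · simp

end Summit.Parity.GeneralizedHardyLittlewood.Theorems.CosetDecorrelation.FareyLevelMeanCoupling
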